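import Summits.NavierStokesRegularity.NavierStokesRegularity.Theses.AmplitudeIndex
import HarnessLib.Audit

/-!
# Birth skeleton (BC3) of the crux `AmplitudeIndex.StableTangentFlowLiouville`

(crux item `stmt-NavierStokesRegularity-10563`, rank 3, route `route-NavierStokesRegularity-AmplitudeIndex`;
tree path `Cruxes/StableTangentFlowLiouville/Lines/birth.lean`; registrar
`planner-skel-stmt-NavierStokesRegularity-10563-0`, 2026-08-17. The route predates the Lean birth
certificate; this file supplies BC3 retroactively.)

THE CRUX (S, fixed — the route's decl, concluded below BY NAME). Every `v` of the tangent-flow class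
`𝒯` — ancient mild (duality form, `ν = 1`), `C^∞` on `t < 0`, Type I in time `‖v(t,x)‖ ≤ C/√(−t)` — which
is ENSTROPHY-STABLE in backward similarity variables (`U(s,y) = e^{−s/2} v(−e^{−s}, e^{−s/2}y)`; the
pre-symmetrised second variation `P_s(w,w) ≤ 0` of the Leray-normalised enstrophy for every `C_c^∞`
divergence-free test velocity `w` that is `B_s`-orthogonal to the ten-parameter symmetry/amplitude family
of `U(s)`) is irrotational: `curl v ≡ 0` on `t < 0`.

THE CUT — "reduce the Bernstein theorem to the α-LIMIT of the orbit, then kill every orbit that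
EMANATES FROM THE IRROTATIONAL SET with the flat-`L²` enstrophy gap `¼`".  `v ∈ 𝒯` is the same thing
as a bounded ENTIRE orbit `s ↦ U(s)` of the profile semiflow; `s → −∞` is the far past `t → −∞`
(zoom-OUT limits `λv(λ²t, λx)`, `λ → ∞`), `s → +∞` is `t → 0⁻`.  In flat `L²(dy)` for the VORTICITY
`Ω = curl U = (−t)·ω` the linearisation of the Leray vorticity equation at the zero profile is
`L = Δ − ½y·∇ − 1` with `⟨LΩ, Ω⟩ = −‖∇Ω‖² − ¼‖Ω‖²` (the route's frame constant, § Numbers): the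
irrotational set `{Ω ≡ 0}` is a STRICT ATTRACTOR of the forward profile flow and therefore has no
unstable manifold — no nontrivial entire orbit can emanate from it.  Hence S splits into

* `stub_stablePastExtinction` [XL, OPEN — the load-bearing core = S restricted to α-limit sets]:
  an enstrophy-stable `v ∈ 𝒯` (given, in addition, the regularity package of stub 2) has VANISHING
  TYPE-I VORTICITY MODULUS IN THE FAR PAST: `∀ ε > 0 ∃ t₀ < 0 ∀ t < t₀ ∀ x, (−t)‖curl v(t,x)‖ ≤ ε`, i.e.
  `‖Ω(s)‖_∞ → 0` as `s → −∞`; equivalently (compactness of `𝒯` modulo scaling and translations,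
  KNSS 2009 §6 / Seregin–Šverák 2009 §2) every zoom-out limit of a stable orbit is irrotational.  Why
  it is EASIER than S: α-limit sets are compact invariant sets of the scaling flow carrying recurrent
  orbits and invariant measures, so the amplitude identity `∫P_s(U,U)ds = [‖Ω‖²] + ∫(‖∇Ω‖² + ¼‖Ω‖²)`
  (route support `AmplitudeMountainPass`) loses its boundary terms on average and the linearised
  cocycle `A_s` has a Lyapunov/Floquet index (Oseledets) — the DSS case (`U` periodic in `s`) is the
  exactly periodic member, the route's foreseen `S_dss`; the Schoen–Simon–Yau insertions of the card are
  to be run THERE, against time-averaged identities.  Why it might fail: exactly the crux's refuter — one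
  enstrophy-stable λ-DSS / recurrent Type-I ancient solution (TypeIDSSLiouvilleConjecture is open,
  Bradshaw–Tsai 2017 OP 5.1); it IS the open core, in its weakest (asymptotic) form.
* `stub_typeIRegularity` [L, KNOWN mathematics — Serrin 1962 interior regularity / KNSS 2009 Prop. 4.1
  smoothing + de Rham]: a smooth duality-form ancient mild solution with the Type-I time bound solves
  Navier–Stokes CLASSICALLY on `(−∞,0) × ℝ³` with some jointly smooth pressure (the defect
  `∂ₜv + (v·∇)v − Δv` is orthogonal to divergence-free tests, hence a gradient; Poincaré-lemma
  potential), and obeys the scaled derivative envelopes `‖∇ⁿv(t,x)‖ ≤ K/√(−t)^{n+1}`, `n ≤ 3` (scaling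
  + interior estimates for bounded solutions; the duality class = Oseen-mild class up to Galilean
  frames `x ↦ x − B(t)`, `b = B′`, KNSS 2009 §1, which do not affect spatial derivatives).  Why it might
  fail (as an item): the duality-form class of the tree is larger than KNSS's mild class; the Galilean
  reduction is folklore but unwritten in the tree.
* `stub_pastExtinctionLiouville` [L, PROVABLE-TYPE — the enstrophy gap of the zero profile]: a classical
  Navier–Stokes solution on the past with the scaled envelopes (`n ≤ 3`) whose Type-I vorticity modulus
  vanishes in the far past is irrotational.  Proof sketch (no mildness needed — only the vorticity
  equation `∂ₛΩ = curl((U + ½y) × Ω) + ΔΩ`, tree `IsClassicalNSSolutionOn.lerayVorticity_eq_curl_cross`):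
  with the slowly varying weight `ρ_R(y) = (1 + |y|²/R²)^{−3}` (decay `|y|^{−6}` makes `|y||∇Ω||Ω|ρ_R`
  integrable for bounded `Ω`, `∇Ω`; `|∇ρ_R| ≤ (6/R)ρ_R`) the weighted enstrophy `E(s) = ∫|Ω(s)|²ρ_R` is
  finite and satisfies `E′ ≤ −(½ − c(K)/R − 2‖∇U(s)‖_∞)E` (transport by the divergence-free wind is
  `L²`-skew up to the `O(1/R)` weight error; the drift `−½y·∇` only helps since `y·∇ρ_R ≤ 0`; `−1` and
  `Δ` give `−‖Ω‖² − ‖∇Ω‖²` up to `O(1/R)`), while `‖∇U(s)‖_∞ ≲ √‖curl Ω(s)‖_∞ + 1/R′ → 0` as `s → −∞` (elliptic trade-off for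
  the bounded div-free field `U` with `ΔU = −curl Ω`, and `‖∇Ω‖_∞ ≤ c‖Ω‖_∞^{1/2}‖∇²Ω‖_∞^{1/2} → 0` by
  the hypothesis and the `n = 3` envelope); so `E′ ≤ −¼E` on `s ≤ s₀`, and `E` bounded as `s → −∞`
  forces `E ≡ 0` on `s ≤ s₀` (backward Grönwall from `s₁ → −∞`); forward of `s₀` the same weighted
  estimate without smallness (`E′ ≤ C E`, `E(s₀) = 0`) gives `Ω ≡ 0`.  Why it might fail (as an item):
  only through the justification of the weighted energy identity (differentiation under the integral;
  the `|y|`-growth of the drift term is absorbed by the `|y|^{−6}` weight and the `n ≤ 3` envelopes).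

`StableTangentFlowLiouville_of : Sig.stub₁ → Sig.stub₂ → Sig.stub₃ → StableTangentFlowLiouville` is the
real composition (regularity package from stub 2, far-past extinction from stub 1, rigidity from
stub 3), and `StableTangentFlowLiouville_proof : StableTangentFlowLiouville` applies it to the three
registered stubs (the ONLY `sorry`s of the file).  The `Sig.stub_*` definitions repeat the stub
statements verbatim so that the composition's hypotheses are the registered obligations BY NAME.

Position w.r.t. the crux and the summit (BC3 probes, registrar folder `bc/probe_<stub>.lean`, quoted
in the registrar's NOTES.md): for each stub statement `X`, `X → StableTangentFlowLiouville` and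
`X → NavierStokesRegularity` by `first | exact? | simpa [X] | (unfold X; simpa) | aesop` FAIL.  Stub 1 is a
CONSEQUENCE of S (an irrotational field has zero modulus) and is used toward S — the redirect is
`S ⟸ stub 1` THROUGH stub 3 (the gap lemma), not a restatement; stub 3 alone does not give S (its
extinction hypothesis is what stability must supply); stub 2 is regularity theory.

Disproof used: none on file for this crux (`ledger crux ls stmt-NavierStokesRegularity-10563`: no
workfiles, 2026-08-17).  Negatives index of the summit: no refuted statement concerns enstrophy
stability, far-past vorticity moduli or Type-I ancient regularity, so no stub is an instance of a
refuted statement.  The parasitic classes recorded in the tree are honoured: `x`-independent `b(t)`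
(`ParasiticSlabFlow`, KNSS 2009 §1) and Galilean frames have `curl ≡ 0` resp. translated vorticity, and
every statement here is made on `curl v` (translation-invariant sup-moduli), exactly as the crux is.

References: Koch–Nadirashvili–Seregin–Šverák, Acta Math. 203 (2009) = arXiv:0709.3599, §1, §4
(Prop. 4.1), §6; Seregin–Šverák, Comm. PDE 34 (2009) = arXiv:0804.1803, §2; Serrin, Arch. Rational
Mech. Anal. 9 (1962) 187–195 (interior regularity); Chae–Wolf, arXiv:1610.09464, §4 (Leray vorticity
system); Giga–Kohn, CPAM 38 (1985) §2–3 and Merle–Zaag, CPAM 51 (1998) Thm 1 (Liouville theorems for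
bounded entire orbits of a profile flow: nothing emanates from the stable zero profile); Simons, Ann.
Math. 88 (1968); Schoen–Simon–Yau, Acta Math. 134 (1975); Colding–Minicozzi, Ann. Math. 175 (2012)
(entropy-stability via the self-shrinker's own H-direction = the amplitude direction here).
-/

noncomputable section

namespace Summit.NavierStokesRegularity.NavierStokesRegularity.Cruxes.StableTangentFlowLiouville.Birth

open scoped BigOperators Topology Manifold Classical MeasureTheory ProbabilityTheory Matrix InnerProductSpace ComplexConjugate ContinuousMap
open Filter Set Function TopologicalSpace MeasureTheory

set_option linter.unusedVariables false
set_option linter.dupNamespace false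

/-! ## Statements of the stubs (`Sig.*`, sorry-free `def`s; the composition takes them BY NAME) -/

/-- Statement of stub 1 `stub_stablePastExtinction` (the open core): an enstrophy-stable `v ∈ 𝒯` (with the
regularity package of stub 2 among the hypotheses) has vanishing Type-I vorticity modulus in the far past. -/
def Sig.stub_stablePastExtinction : Prop :=
  ∀ v : ℝ → EuclideanSpace ℝ (Fin 3) → EuclideanSpace ℝ (Fin 3), Literature.Analysis.FluidPDE.IsAncientMildSolution 1 v → ContDiffOn ℝ (⊤ : ℕ∞) (Function.uncurry v) (Set.Iio 0 ×ˢ Set.univ) → (∃ C : ℝ, Literature.Analysis.FluidPDE.HasTypeITimeDecay C v) → (∃ p : ℝ → EuclideanSpace ℝ (Fin 3) → ℝ, Literature.Analysis.FluidPDE.IsClassicalNSSolutionOn (Set.Iio 0) 1 0 v p) → (∀ n : ℕ, n ≤ 3 → ∃ K : ℝ, ∀ t < 0, ∀ x : EuclideanSpace ℝ (Fin 3), ‖iteratedFDeriv ℝ n (v t) x‖ ≤ K / Real.sqrt (-t) ^ (n + 1)) → (let curl := Literature.Analysis.FluidPDE.curl; let cross := Literature.Analysis.FluidPDE.cross; let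 U := fun (s : ℝ) (y : EuclideanSpace ℝ (Fin 3)) => Real.exp (-s / 2) • v (-Real.exp (-s)) (Real.exp (-s / 2) • y); let P := fun s w w' => ∫ y, (-(∑ i : Fin 3, inner ℝ (fderiv ℝ (curl w) y (EuclideanSpace.single i (1 : ℝ))) (fderiv ℝ (curl w') y (EuclideanSpace.single i (1 : ℝ)))) - (1 / 4 : ℝ) * inner ℝ (curl w y) (curl w' y) + inner ℝ (cross (U s y) (curl w y) + cross (w y) (curl (U s) y)) (curl (curl w') y)); let B := fun s w w' => P s w w' + P s w' w; ∀ s w, ContDiff ℝ (⊤ : ℕ∞) w → HasCompactSupport w → Literature.Analysis.FluidPDE.VectorCalculus.IsDivFree w → (∀ a (σ τ ρ : ℝ), ∀ A ∈ skewAdjoint (EuclideanSpace ℝ (Fin 3) →L[ℝ] EuclideanSpace ℝ (Fin 3)), B s w (fun y => fderiv ℝ (U s) y (a + σ • y + A y) + (σ + τ) • U s y - A (U s y) + ρ • Literature.Analysis.FluidPDE.timeDeriv U s y) = 0) → P s w w ≤ 0) → (∀ ε : ℝ, 0 < ε → ∃ t₀ : ℝ, t₀ < 0 ∧ ∀ t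 < t₀, ∀ x : EuclideanSpace ℝ (Fin 3), (-t) * ‖Literature.Analysis.FluidPDE.curl (v t) x‖ ≤ ε)

/-- Statement of stub 2 `stub_typeIRegularity` (known regularity package): classical on the past with a
smooth pressure, and scaled derivative envelopes up to order three. -/
def Sig.stub_typeIRegularity : Prop :=
  ∀ v : ℝ → EuclideanSpace ℝ (Fin 3) → EuclideanSpace ℝ (Fin 3), Literature.Analysis.FluidPDE.IsAncientMildSolution 1 v → ContDiffOn ℝ (⊤ : ℕ∞) (Function.uncurry v) (Set.Iio 0 ×ˢ Set.univ) → (∃ C : ℝ, Literature.Analysis.FluidPDE.HasTypeITimeDecay C v) → (∃ p : ℝ → EuclideanSpace ℝ (Fin 3) → ℝ, Literature.Analysis.FluidPDE.IsClassicalNSSolutionOn (Set.Iio 0) 1 0 v p) ∧ (∀ n : ℕ, n ≤ 3 → ∃ K : ℝ, ∀ t < 0, ∀ x : EuclideanSpace ℝ (Fin 3), ‖iteratedFDeriv ℝ n (v t) x‖ ≤ K / Real.sqrt (-t) ^ (n + 1))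

/-- Statement of stub 3 `stub_pastExtinctionLiouville` (the enstrophy gap of the zero profile): far-past
extinction of the vorticity modulus forces a classical Type-I solution on the past to be irrotational. -/
def Sig.stub_pastExtinctionLiouville : Prop :=
  ∀ (v : ℝ → EuclideanSpace ℝ (Fin 3) → EuclideanSpace ℝ (Fin 3)) (p : ℝ → EuclideanSpace ℝ (Fin 3) → ℝ), Literature.Analysis.FluidPDE.IsClassicalNSSolutionOn (Set.Iio 0) 1 0 v p → (∀ n : ℕ, n ≤ 3 → ∃ K : ℝ, ∀ t < 0, ∀ x : EuclideanSpace ℝ (Fin 3), ‖iteratedFDeriv ℝ n (v t) x‖ ≤ K / Real.sqrt (-t) ^ (n + 1)) → (∀ ε : ℝ, 0 < ε → ∃ t₀ : ℝ, t₀ < 0 ∧ ∀ t < t₀, ∀ x : EuclideanSpace ℝ (Fin 3), (-t) * ‖Literature.Analysis.FluidPDE.curl (v t) x‖ ≤ ε) → ∀ t < 0, ∀ x, Literature.Analysis.FluidPDE.curl (v t) x = 0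

/-! ## Registered stubs (the only `sorry`s of the file) -/

/-- **Stub 1 — `stub_stablePastExtinction` (XL, OPEN; the load-bearing core — S on α-limit sets).**
For `v` ancient mild (duality form, `ν = 1`), `C^∞` on `t < 0`, Type I in time, classical on the past
with some smooth pressure and with the scaled envelopes `‖∇ⁿv‖ ≤ K/√(−t)^{n+1}` (`n ≤ 3`): if `v` is
enstrophy-stable (verbatim the crux's hypothesis — `P_s(w,w) ≤ 0` for every `s` and every `C_c^∞`
divergence-free `w` that is `B_s`-orthogonal to the ten-parameter symmetry/amplitude family of
`U(s) = e^{−s/2}v(−e^{−s}, e^{−s/2}·)`), then `(−t)‖curl v(t,x)‖ → 0` uniformly in `x` as `t → −∞`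
(every zoom-out limit of the orbit is irrotational).  Sources: Simons 1968; Schoen–Simon–Yau 1975;
Colding–Minicozzi 2012 (stability modulo the H-direction); KNSS 2009 §6; Chae–Wolf 2017 Thm 1.3
(λ-DSS, λ near 1); Bradshaw–Tsai 2017 OP 5.1 (why it might fail). -/
theorem stub_stablePastExtinction :
    ∀ v : ℝ → EuclideanSpace ℝ (Fin 3) → EuclideanSpace ℝ (Fin 3), Literature.Analysis.FluidPDE.IsAncientMildSolution 1 v → ContDiffOn ℝ (⊤ : ℕ∞) (Function.uncurry v) (Set.Iio 0 ×ˢ Set.univ) → (∃ C : ℝ, Literature.Analysis.FluidPDE.HasTypeITimeDecay C v) → (∃ p : ℝ → EuclideanSpace ℝ (Fin 3) → ℝ, Literature.Analysis.FluidPDE.IsClassicalNSSolutionOn (Set.Iio 0) 1 0 v p) → (∀ n : ℕ, n ≤ 3 → ∃ K : ℝ, ∀ t < 0, ∀ x : EuclideanSpace ℝ (Fin 3), ‖iteratedFDeriv ℝ n (v t) x‖ ≤ K / Real.sqrt (-t) ^ (n + 1)) → (let curl := Literature.Analysis.FluidPDE.curl; let cross := Literature.Analysis.FluidPDE.cross;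 let U := fun (s : ℝ) (y : EuclideanSpace ℝ (Fin 3)) => Real.exp (-s / 2) • v (-Real.exp (-s)) (Real.exp (-s / 2) • y); let P := fun s w w' => ∫ y, (-(∑ i : Fin 3, inner ℝ (fderiv ℝ (curl w) y (EuclideanSpace.single i (1 : ℝ))) (fderiv ℝ (curl w') y (EuclideanSpace.single i (1 : ℝ)))) - (1 / 4 : ℝ) * inner ℝ (curl w y) (curl w' y) + inner ℝ (cross (U s y) (curl w y) + cross (w y) (curl (U s) y)) (curl (curl w') y)); let B := fun s w w' => P s w w' + P s w' w; ∀ s w, ContDiff ℝ (⊤ : ℕ∞) w → HasCompactSupport w → Literature.Analysis.FluidPDE.VectorCalculus.IsDivFree w → (∀ a (σ τ ρ : ℝ), ∀ A ∈ skewAdjoint (EuclideanSpace ℝ (Fin 3) →L[ℝ] EuclideanSpace ℝ (Fin 3)), B s w (fun y => fderiv ℝ (U s) y (a + σ • y + A y) + (σ + τ) • U s y - A (U s y) + ρ • Literature.Analysis.FluidPDE.timeDeriv U s y) = 0) → P s w w ≤ 0) → (∀ ε : ℝ, 0 < ε → ∃ t₀ : ℝ, t₀ < 0 ∧ ∀ t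 < t₀, ∀ x : EuclideanSpace ℝ (Fin 3), (-t) * ‖Literature.Analysis.FluidPDE.curl (v t) x‖ ≤ ε) := by
  sorry

/-- **Stub 2 — `stub_typeIRegularity` (L, KNOWN: de Rham + Serrin 1962 / KNSS 2009 Prop. 4.1 by scaling).**
A smooth duality-form ancient mild solution (`ν = 1`) with the Type-I time bound is a CLASSICAL
Navier–Stokes solution on `(−∞, 0) × ℝ³` for some jointly smooth pressure, and satisfies the scaled
derivative envelopes `‖∇ⁿv(t,x)‖ ≤ K_n/√(−t)^{n+1}` for `n ≤ 3` (`n = 0` is the Type-I bound itself). -/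
theorem stub_typeIRegularity :
    ∀ v : ℝ → EuclideanSpace ℝ (Fin 3) → EuclideanSpace ℝ (Fin 3), Literature.Analysis.FluidPDE.IsAncientMildSolution 1 v → ContDiffOn ℝ (⊤ : ℕ∞) (Function.uncurry v) (Set.Iio 0 ×ˢ Set.univ) → (∃ C : ℝ, Literature.Analysis.FluidPDE.HasTypeITimeDecay C v) → (∃ p : ℝ → EuclideanSpace ℝ (Fin 3) → ℝ, Literature.Analysis.FluidPDE.IsClassicalNSSolutionOn (Set.Iio 0) 1 0 v p) ∧ (∀ n : ℕ, n ≤ 3 → ∃ K : ℝ, ∀ t < 0, ∀ x : EuclideanSpace ℝ (Fin 3), ‖iteratedFDeriv ℝ n (v t) x‖ ≤ K / Real.sqrt (-t) ^ (n + 1)) := by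
  sorry

/-- **Stub 3 — `stub_pastExtinctionLiouville` (L, provable-type: the flat-`L²` enstrophy gap `¼` of the
zero profile in backward similarity variables).**  A classical Navier–Stokes solution on the past
(`ν = 1`, zero force, any smooth pressure) with the scaled envelopes up to order three whose Type-I
vorticity modulus `(−t)‖curl v(t,·)‖_∞` tends to `0` as `t → −∞` is irrotational on `t < 0`: nothing
nontrivial emanates from the irrotational set, because `⟨(Δ − ½y·∇ − 1)Ω, Ω⟩ = −‖∇Ω‖² − ¼‖Ω‖²`
(weighted version with `ρ_R = (1 + |y|²/R²)^{−3}`, `R → ∞`; Giga–Kohn / Merle–Zaag-type Liouville for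
entire orbits of a profile flow, here at the STABLE end). -/
theorem stub_pastExtinctionLiouville :
    ∀ (v : ℝ → EuclideanSpace ℝ (Fin 3) → EuclideanSpace ℝ (Fin 3)) (p : ℝ → EuclideanSpace ℝ (Fin 3) → ℝ), Literature.Analysis.FluidPDE.IsClassicalNSSolutionOn (Set.Iio 0) 1 0 v p → (∀ n : ℕ, n ≤ 3 → ∃ K : ℝ, ∀ t < 0, ∀ x : EuclideanSpace ℝ (Fin 3), ‖iteratedFDeriv ℝ n (v t) x‖ ≤ K / Real.sqrt (-t) ^ (n + 1)) → (∀ ε : ℝ, 0 < ε → ∃ t₀ : ℝ, t₀ < 0 ∧ ∀ t < t₀, ∀ x : EuclideanSpace ℝ (Fin 3), (-t) * ‖Literature.Analysis.FluidPDE.curl (v t) x‖ ≤ ε) → ∀ t < 0, ∀ x, Literature.Analysis.FluidPDE.curl (v t) x = 0 := by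
  sorry

/-! ## The composition (sorry-free): the stubs prove the crux BY NAME -/

/-- **The skeleton concludes the crux `StableTangentFlowLiouville` (stmt-NavierStokesRegularity-10563)
BY NAME** from the three registered stub statements: the regularity package (stub 2) feeds both the
core (stub 1: stability ⇒ far-past extinction of the vorticity modulus) and the gap lemma (stub 3:
far-past extinction ⇒ irrotational). -/
theorem StableTangentFlowLiouville_of :
    Sig.stub_stablePastExtinction → Sig.stub_typeIRegularity → Sig.stub_pastExtinctionLiouville →
      Summit.NavierStokesRegularity.NavierStokesRegularity.Theses.AmplitudeIndex.StableTangentFlowLiouville := by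
  intro h1 h2 h3 v hmild hsmooth hdecay hstab
  -- stub 2: classical on the past with a smooth pressure, scaled envelopes up to order three
  obtain ⟨⟨p, hcl⟩, henv⟩ := h2 v hmild hsmooth hdecay
  -- stub 1: enstrophy stability ⇒ the Type-I vorticity modulus vanishes in the far past
  have hext := h1 v hmild hsmooth hdecay ⟨p, hcl⟩ henv hstab
  -- stub 3: far-past extinction ⇒ irrotational
  exact h3 v p hcl henv hext

/-- The crux itself from the registered stubs (only `stub_*` carry `sorry`). -/
theorem StableTangentFlowLiouville_proof :
    Summit.NavierStokesRegularity.NavierStokesRegularity.Theses.AmplitudeIndex.StableTangentFlowLiouville :=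
  StableTangentFlowLiouville_of stub_stablePastExtinction stub_typeIRegularity stub_pastExtinctionLiouville

end Summit.NavierStokesRegularity.NavierStokesRegularity.Cruxes.StableTangentFlowLiouville.Birth

end
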